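import Summits.AtomisticToContinuum.Crystallization.Theorems.FrustratedLawDichotomyStrainedPatchHomTermEval

/-!
# A range-safe validated square root for the window terms (`q ∈ [16, 81/4]`) of the `HomFloor` leaf replay

decomp-a2c hand-2 g21 (crux `AperiodicFrustratedLawGap`, stmt-AtomisticToContinuum-27623).  FINDING (native probe, HOME/decomp-a2c-hand-2/g21/HAND2-G21.md §2):
the Literature kernel's `FI.sqrt` is SOUND everywhere but TIGHT only for arguments `< 16` at scale `2^48` (its Newton seed is `2^50`; for `x ≥ 16` it returns
`[4, ≈ x·2^48]`), while the record potential's window runs to `q = 81/4 > 16`.  Consequently the landed v1 checks (`winOK`, the `81/4`-straddle piece of `curvOK`,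
the window branches of `valLoOK`/`derivOK`) are sound but INEFFECTIVE for terms with `q > 16` (`r > 4`).  The repair is the rescaling `√q = 2·√(q/4)`:

* `sqrtW Q := if Q.hi < 16·SC then FI.sqrt Q else (FI.sqrt (FI.divNat Q 4)).mulInt 2` (tight on the whole window since `q/4 < 16`);
* `mem_sqrtW : FI.mem x Q → FI.mem (√x) (sqrtW Q)`;
* the two endpoint facts the term-check soundness proofs consume, in `sqrtW` form: `sqrtWLo_sq_le`, `le_sqrtWHi_sq` —
  so the v2 term checks are a search/replace `FI.sqrt ↦ sqrtW` in `…TermEval` / `…TermEvalPoint` with the same proofs (next hand).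

Computable; 0 sorry; standard axioms.  `--supports stmt-AtomisticToContinuum-27623`.
-/

namespace Summit.AtomisticToContinuum.Crystallization.Theorems.FrustratedLawDichotomyStrainedPatchHomTermSqrt

open Literature.Analysis.ValidatedNumerics.Numerics

/-- Range-safe validated square root: below `16` the Literature `FI.sqrt`, above it `2·√(x/4)`. -/
def sqrtW (Q : FI) : FI := if Q.hi < 16 * (SC : ℤ) then FI.sqrt Q else (FI.sqrt (FI.divNat Q 4)).mulInt 2

/-- Soundness of `sqrtW`. [folklore] -/
theorem mem_sqrtW {x : ℝ} {Q : FI} (hx : FI.mem x Q) : FI.mem (Real.sqrt x) (sqrtW Q) := by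
  unfold sqrtW
  split_ifs with h
  · exact FI.mem_sqrt hx
  · have h4 := FI.mem_sqrt (FI.mem_divNat hx (n := 4) (by norm_num))
    have h2 := FI.mem_mulInt h4 2
    have e : Real.sqrt (x / (4:ℕ)) * ((2:ℤ) : ℝ) = Real.sqrt x := by
      have : Real.sqrt (x / (4:ℕ)) = Real.sqrt x / 2 := by
        rw [show ((4:ℕ) : ℝ) = 2 ^ 2 by norm_num, Real.sqrt_div' _ (by norm_num), Real.sqrt_sq (by norm_num)]
      rw [this]; push_cast; ring
    rw [e] at h2
    exact h2

/-- Lower endpoint: `s₁ := (sqrtW Q).lo/SC` satisfies `s₁² ≤ q` when `0 < (sqrtW Q).lo`. [folklore] -/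
theorem sqrtWLo_sq_le {q : ℝ} {Q : FI} (hq : FI.mem q Q) (h0 : 0 < (sqrtW Q).lo) : (((sqrtW Q).lo : ℝ) / SC) ^ 2 ≤ q := by
  have hs := mem_sqrtW hq
  have h1 : ((sqrtW Q).lo : ℝ) / SC ≤ Real.sqrt q := FI.lo_div_le hs
  have h0' : (0:ℝ) < ((sqrtW Q).lo : ℝ) / SC := div_pos (by exact_mod_cast h0) SC_pos
  have hsq : 0 < Real.sqrt q := h0'.trans_le h1
  have hq0 : 0 ≤ q := le_of_lt (Real.sqrt_pos.1 hsq)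
  calc (((sqrtW Q).lo : ℝ) / SC) ^ 2 ≤ Real.sqrt q ^ 2 := pow_le_pow_left₀ h0'.le h1 2
    _ = q := Real.sq_sqrt hq0

/-- Upper endpoint: `s₂ := (sqrtW Q).hi/SC` satisfies `q ≤ s₂²` and `0 ≤ s₂` when `0 ≤ (sqrtW Q).hi`. [folklore] -/
theorem le_sqrtWHi_sq {q : ℝ} {Q : FI} (hq : FI.mem q Q) (h0 : 0 ≤ (sqrtW Q).hi) :
    q ≤ (((sqrtW Q).hi : ℝ) / SC) ^ 2 ∧ 0 ≤ ((sqrtW Q).hi : ℝ) / SC := by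
  have hs := mem_sqrtW hq
  have h1 : Real.sqrt q ≤ ((sqrtW Q).hi : ℝ) / SC := FI.le_hi_div hs
  have h0' : (0:ℝ) ≤ ((sqrtW Q).hi : ℝ) / SC := div_nonneg (by exact_mod_cast h0) SC_pos.le
  refine ⟨?_, h0'⟩
  rcases le_or_gt 0 q with hq0 | hq0
  · calc q = Real.sqrt q ^ 2 := (Real.sq_sqrt hq0).symm
      _ ≤ _ := pow_le_pow_left₀ (Real.sqrt_nonneg q) h1 2
  · exact hq0.le.trans (sq_nonneg _)

/-- Kernel smoke test: tight on both sides of `16` (`√18·SC ∈ [lo, hi]` with `hi − lo ≤ 2`, whereas `FI.sqrt` alone is `[4·SC, ≈ 18·SC²]` there). -/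
example : (sqrtW (FI.ofScaled (18 * (SC : ℤ)))).hi - (sqrtW (FI.ofScaled (18 * (SC : ℤ)))).lo ≤ 2 ∧
    (sqrtW (FI.ofScaled (12 * (SC : ℤ)))).hi - (sqrtW (FI.ofScaled (12 * (SC : ℤ)))).lo ≤ 2 := by decide +kernel

end Summit.AtomisticToContinuum.Crystallization.Theorems.FrustratedLawDichotomyStrainedPatchHomTermSqrt
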